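import Summits.CriticalPhenomena.SAWScalingLimit.Theorems.SAWRenewalTightnessSubseqIdentificationTiltedProductInterior
import Summits.CriticalPhenomena.SAWScalingLimit.Theorems.SAWRenewalTightnessSubseqIdentificationTiltedProductEstimate
import HarnessLib

/-!
# The tilted martingale identities (line `boundary-area-law`, RS5b′/T2, Π): `Mⁿ · Lᵏ` is a martingale

Line `boundary-area-law` of the crux `SubseqIdentification` (stmt-CriticalPhenomena-0783), restriction
reshape (lead c4, r-c4-5), **stub `stub_tiltedProductMartingale` (Π)** = half of step (T2) of the tilted
[LSW] Theorem 6.5 (G. F. Lawler, O. Schramm, W. Werner, *Conformal restriction: the chordal case*,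
J. Amer. Math. Soc. **16** (2003), §5 (5.1)–(5.3) and Prop. 5.3): for `0 < κ ≤ 8/3`, `α = (6−κ)/(2κ)`,
`λ = (8−3κ)(6−κ)/(2κ)`, a nonempty `*`-hull `A` and levels `n ≤ k`, **the product `Mⁿ · Lᵏ` of the
localised image driving function `Mⁿ = imgMartK κ hA hne n` (`h_t(W_t)` stopped at `imgLocTimeK n`) with the
localised compensated restriction martingale `Lᵏ = locMartK κ α λ hA hne k` (`h_t′(W_t)^α e^{−λ∫m}` stopped
at `locTimeK k`) is an `𝓕`-martingale of the driving Brownian motion** — in print Itô: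
`d(W̃Ỹ) = W̃ dỸ + Ỹ dW̃ + d⟨W̃, Ỹ⟩ = (mart) + Ỹ h″(W)(κ/2 − 3 + κα) dt`, `κα = 3 − κ/2`.

Last of four files, sequel of `…TiltedProductCell` / `…TiltedProductInterior` / `…TiltedProductEstimate`
(CELL SCHEME, no stochastic calculus): in the partition bound `abs_setIntegral_prod_sub_le_of_partition` (with
the interior constant of `exists_abs_integral_mul_prod_le` at horizon `t`), letting the mesh go to `0` and then
the oscillation threshold `κ₀ → 0` gives
`∫_S (M_t L_t − M_s L_s) = 0` for `S ∈ 𝓕_s` (`setIntegral_prod_sub_eq_zero`), whence the martingale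
(`martingale_imgMartK_mul_locMartK`, registered form `stub_tiltedProductMartingale`; bounded: `|Mⁿ| ≤ N₀`, `Lᵏ ∈ [0, 1]`).

References: [LSW] §5 (5.1)–(5.3), Prop. 5.3. No named fact is used.
-/

noncomputable section

open MeasureTheory Filter Topology Set Metric Function
open scoped NNReal ENNReal
open Literature.Probability.RandomPlanarGeometry
open Literature.Probability.Process (preWienerMeasure runSup)

namespace Summit.CriticalPhenomena.SAWScalingLimit.Theorems.SubseqIdentification.BoundaryAreaLaw

open Loewner PathOps

variable {κ : ℝ≥0} {α lam : ℝ} (hκ0 : 0 < κ) (hκ : κ ≤ 8 / 3) (hαdef : α = (6 - κ) / (2 * κ))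
  (hlamdef : lam = (8 - 3 * κ) * (6 - κ) / (2 * κ))
  {A : Set ℂ} {hA : IsStarHull A} {hne : A.Nonempty} {n k : ℕ}

/-! ### The increments of `Mⁿ · Lᵏ` integrate to zero over `𝓕_s`-events -/

section Zero

include hκ0 hκ hαdef hlamdef in
/-- **`∫_S (M_t L_t − M_s L_s) = 0` for `s ≤ t`, `S ∈ 𝓕_s`, `n ≤ k`**: let the mesh of the partition go to
`0` (the sum of the cell bounds tends to `8κ₀`), then the oscillation threshold `κ₀ → 0`.
[cite: LawlerSchrammWerner2003Restriction, §5 (5.1)–(5.3) and Prop. 5.3] -/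
theorem setIntegral_prod_sub_eq_zero (hnk : n ≤ k) {s t : ℝ≥0} (hst : s ≤ t) {S : Set (ℝ≥0 → ℝ)}
    (hS : MeasurableSet[brownianFiltration s] S) :
    ∫ ω in S, (imgMartK κ hA hne n t ω * locMartK κ α lam hA hne k t ω -
        imgMartK κ hA hne n s ω * locMartK κ α lam hA hne k s ω) ∂preWienerMeasure = 0 := by
  -- adapted from SLEImageMartingale.lean (`setIntegral_imgMartK_sub_eq_zero`) and SLERestrictionLocalMartingaleKappa.lean
  letI : MeasurableSpace C(ℝ≥0, ℝ) := borel _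
  haveI : BorelSpace C(ℝ≥0, ℝ) := ⟨rfl⟩
  rcases hst.eq_or_lt with heq | hst'
  · subst heq; simp
  obtain ⟨hc0, hc1⟩ := locLevel_pos_le n
  have hσ := stepSigma_pos
  set c := locLevel n with hc
  -- the radius of `A` and the interior constant at horizon `t`
  obtain ⟨R₁, hR₁⟩ := hA.isBoundedHull.isCompact.isBounded.subset_closedBall (0 : ℂ)
  set R : ℝ := max R₁ 1 with hR
  have hR0 : 0 < R := lt_max_of_lt_right one_pos
  have hAR : A ⊆ closedBall (0 : ℂ) R := hR₁.trans (closedBall_subset_closedBall (le_max_left _ _))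
  obtain ⟨C, -, hC⟩ := exists_abs_integral_mul_prod_le hκ0 hκ hαdef hlamdef hA hne n hR0 hAR t
  set I : ℝ := ∫ ω in S, (imgMartK κ hA hne n t ω * locMartK κ α lam hA hne k t ω -
    imgMartK κ hA hne n s ω * locMartK κ α lam hA hne k s ω) ∂preWienerMeasure with hI
  have hts : (0 : ℝ) < (t : ℝ) - s := by have : (s : ℝ) < t := (by exact_mod_cast hst'); linarith
  -- the mesh `h_N = (t - s)/(N + 1)` and its limits
  set hN : ℕ → ℝ≥0 := fun N ↦ (t - s) / ((N : ℝ≥0) + 1) with hhN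
  have hhN' : ∀ N : ℕ, (((N + 1 : ℕ) : ℝ≥0)) * hN N = t - s := fun N ↦ by
    simp only [hhN]; push_cast; rw [mul_div_cancel₀ _ (by positivity)]
  have hcoe : ∀ N : ℕ, (hN N : ℝ) = ((t : ℝ) - s) / ((N : ℝ) + 1) := fun N ↦ by
    simp only [hhN]; push_cast [NNReal.coe_sub hst]; ring
  have hh_pos : ∀ N, 0 < hN N := fun N ↦ by
    have : (0 : ℝ) < hN N := by rw [hcoe]; positivity
    exact_mod_cast this
  have hh_tend : Tendsto (fun N ↦ (hN N : ℝ)) atTop (𝓝 0) := by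
    simp_rw [hcoe]
    exact tendsto_const_nhds.div_atTop (tendsto_natCast_atTop_atTop.atTop_add tendsto_const_nhds)
  have hsqrt_tend : Tendsto (fun N ↦ Real.sqrt (hN N)) atTop (𝓝 0) := by
    have := (Real.continuous_sqrt.tendsto 0).comp hh_tend
    rwa [Function.comp_def, Real.sqrt_zero] at this
  have hNh : ∀ N : ℕ, ((N + 1 : ℕ) : ℝ) * (hN N : ℝ) = (t : ℝ) - s := fun N ↦ by
    rw [hcoe]; push_cast; field_simp
  -- Step 1: for every small `κ₀ > 0`, `|I| ≤ 8κ₀`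
  have step1 : ∀ κ₀ : ℝ, 0 < κ₀ → κ₀ ≤ c * (c / 16) / 2000 → |I| ≤ 8 * κ₀ := by
    intro κ₀ hκ₀ hκc
    set K : ℝ := ((2 * (((n : ℝ) + 1) + 1160 * (3 * ((n : ℝ) + 1) + 13 * Real.sqrt ((n : ℝ) + 1) + R)) +
        (15080 * Real.sqrt ((t : ℝ) + 1) + 1160 * R) + 3482 * Real.sqrt κ) * (128 / (κ₀ / stepSigma) ^ 4) +
      3482 * Real.sqrt κ * (18 * ((t : ℝ) + 1) ^ 2)) with hK
    set RHS : ℕ → ℝ := fun N ↦ ((N + 1 : ℕ) : ℝ) * (C * hN N * Real.sqrt (hN N)) +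
        (100 * hN N / (c / 16) + 8 * κ₀) + ((N + 1 : ℕ) : ℝ) * (K * hN N * Real.sqrt (hN N)) with hRHS
    have hRHS_eq : ∀ N, RHS N = C * ((t : ℝ) - s) * Real.sqrt (hN N) + (100 * hN N / (c / 16) + 8 * κ₀) +
        K * ((t : ℝ) - s) * Real.sqrt (hN N) := fun N ↦ by
      simp only [hRHS]
      have e := hNh N
      have e1 : ((N + 1 : ℕ) : ℝ) * (C * hN N * Real.sqrt (hN N)) = C * (((N + 1 : ℕ) : ℝ) * hN N) * Real.sqrt (hN N) := by ring
      have e2 : ((N + 1 : ℕ) : ℝ) * (K * hN N * Real.sqrt (hN N)) = K * (((N + 1 : ℕ) : ℝ) * hN N) * Real.sqrt (hN N) := by ring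
      rw [e1, e2, e]
    have hlim : Tendsto RHS atTop (𝓝 (8 * κ₀)) := by
      have h1 : Tendsto (fun N ↦ C * ((t : ℝ) - s) * Real.sqrt (hN N)) atTop (𝓝 0) := by
        have := tendsto_const_nhds (x := C * ((t : ℝ) - s)) |>.mul hsqrt_tend
        rwa [mul_zero] at this
      have h2 : Tendsto (fun N ↦ 100 * (hN N : ℝ) / (c / 16) + 8 * κ₀) atTop (𝓝 (100 * 0 / (c / 16) + 8 * κ₀)) :=
        ((tendsto_const_nhds.mul hh_tend).div_const _).add tendsto_const_nhds
      rw [mul_zero, zero_div, zero_add] at h2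
      have h3 : Tendsto (fun N ↦ K * ((t : ℝ) - s) * Real.sqrt (hN N)) atTop (𝓝 0) := by
        have := tendsto_const_nhds (x := K * ((t : ℝ) - s)) |>.mul hsqrt_tend
        rwa [mul_zero] at this
      have := (h1.add h2).add h3
      rw [zero_add, add_zero] at this
      exact this.congr fun N ↦ (hRHS_eq N).symm
    -- eventually all smallness conditions hold, and then `|I| ≤ RHS N`
    have hK1 : (0 : ℝ) < 3 * (c / 2 * (c / 16) / 4000) ^ 2 / 256 := by positivity
    have hK4 : (0 : ℝ) < (κ₀ / stepSigma / 2) ^ 2 / 2 := by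
      have : 0 < κ₀ / stepSigma := div_pos hκ₀ hσ; positivity
    have hK2 : (0 : ℝ) < c * (c / 16) / 8000 := by positivity
    have h5t : Tendsto (fun N ↦ lam * (hN N * massBdCell n)) atTop (𝓝 0) := by
      have := (tendsto_const_nhds (x := lam)).mul (hh_tend.mul (tendsto_const_nhds (x := massBdCell n)))
      rwa [zero_mul, mul_zero] at this
    have hev : ∀ᶠ N in atTop, |I| ≤ RHS N := by
      filter_upwards [hh_tend.eventually (eventually_le_nhds hK1), hh_tend.eventually (eventually_le_nhds hK4),
        hh_tend.eventually (eventually_le_nhds one_pos), hsqrt_tend.eventually (eventually_le_nhds hK2),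
        h5t.eventually (eventually_le_nhds one_pos)] with N h1 h4 h1' h2b h5
      have hh2 : stepSize κ₀ (hN N) ≤ c * (c / 16) / 1000 := by rw [stepSize]; linarith
      exact abs_setIntegral_prod_sub_le_of_partition (hA := hA) (hne := hne) (n := n) (k := k) hκ0 hκ hαdef hlamdef hnk hR0 hAR
        hC hst le_rfl hS hκ₀ (N := N + 1) (hhN' N) (hh_pos N) h1' h1 hh2 h4 h5
    exact ge_of_tendsto hlim hev
  -- Step 2: `κ₀ → 0`
  have hL : Tendsto (fun κ₀ : ℝ ↦ 8 * κ₀) (𝓝[>] 0) (𝓝 0) := by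
    have h1 : Tendsto (fun κ₀ : ℝ ↦ 8 * κ₀) (𝓝 0) (𝓝 (8 * 0)) := tendsto_const_nhds.mul tendsto_id
    rw [mul_zero] at h1
    exact h1.mono_left nhdsWithin_le_nhds
  have hevκ : ∀ᶠ κ₀ in 𝓝[>] (0 : ℝ), |I| ≤ 8 * κ₀ := by
    have hpos : ∀ᶠ κ₀ in 𝓝[>] (0 : ℝ), 0 < κ₀ := eventually_mem_nhdsWithin
    have hsmall : ∀ᶠ κ₀ in 𝓝[>] (0 : ℝ), κ₀ ≤ c * (c / 16) / 2000 :=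
      (eventually_le_nhds (by positivity : (0 : ℝ) < c * (c / 16) / 2000)).filter_mono nhdsWithin_le_nhds
    filter_upwards [hpos, hsmall] with κ₀ h1 h2
    exact step1 κ₀ h1 h2
  exact abs_nonpos_iff.1 (ge_of_tendsto hL hevκ)

end Zero

/-! ### The martingale -/

section Mart

include hκ0 hκ hαdef hlamdef in
/-- **[LSW] §5 ((5.1)–(5.3) with Prop. 5.3), the product identity `Π` of the tilted Theorem 6.5, localised:**
for `0 < κ ≤ 8/3`, `α = (6 − κ)/(2κ)`, `λ = (8 − 3κ)(6 − κ)/(2κ)`, every nonempty `*`-hull `A` and levels `n ≤ k`,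
the product `Mⁿ · Lᵏ` of the localised image driving function `h_t(W_t)` (stopped at `imgLocTimeK n`) with the
localised compensated restriction martingale `h_t′(W_t)^α e^{−λ∫m}` (stopped at `locTimeK k`) is a bounded
`𝓕`-martingale of the SLE_κ driving Brownian motion. [cite: LawlerSchrammWerner2003Restriction, §5 (5.1)–(5.3) and Prop. 5.3] -/
theorem martingale_imgMartK_mul_locMartK (hnk : n ≤ k) :
    Martingale (fun t ω ↦ imgMartK κ hA hne n t ω * locMartK κ α lam hA hne k t ω) brownianFiltration preWienerMeasure := by
  -- adapted from SLERestrictionLocalMartingaleKappa.lean (`martingale_locMartK`)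
  haveI := isProbabilityMeasure_preWienerMeasure'
  obtain ⟨hαpos, hlam0⟩ := exponents_pos hκ hαdef hlamdef hκ0
  refine ⟨stronglyAdapted_imgMartK_mul_locMartK hαpos, fun i j hij ↦ ?_⟩
  have hm : brownianFiltration i ≤ (inferInstance : MeasurableSpace (ℝ≥0 → ℝ)) := brownianFiltration.le i
  haveI : IsFiniteMeasure (preWienerMeasure.trim hm) := isFiniteMeasure_trim hm
  refine (ae_eq_condExp_of_forall_setIntegral_eq hm (integrable_imgMartK_mul_locMartK hαpos hlam0 j)
    (fun S _ _ ↦ (integrable_imgMartK_mul_locMartK hαpos hlam0 i).integrableOn) (fun S hS _ ↦ ?_)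
    ((stronglyAdapted_imgMartK_mul_locMartK (κ := κ) (hA := hA) (hne := hne) (n := n) (k := k) hαpos i).aestronglyMeasurable)).symm
  have h0 := setIntegral_prod_sub_eq_zero (hA := hA) (hne := hne) (n := n) (k := k) hκ0 hκ hαdef hlamdef hnk hij hS
  rw [integral_sub (integrable_imgMartK_mul_locMartK hαpos hlam0 j).integrableOn (integrable_imgMartK_mul_locMartK hαpos hlam0 i).integrableOn, sub_eq_zero] at h0
  exact h0.symm

end Mart

section Registered

/-- **Registered form (stub `stub_tiltedProductMartingale`, Π, of the reshaped line skeleton r-c4-5)**: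
for all `0 < κ ≤ 8/3`, `α = (6−κ)/(2κ)`, `λ = (8−3κ)(6−κ)/(2κ)`, every nonempty `A ∈ 𝒬*` and levels `n ≤ k`,
`Mⁿ · Lᵏ = imgMartK κ hA hne n · locMartK κ α λ hA hne k` is a martingale of the Brownian filtration.
[cite: LawlerSchrammWerner2003Restriction, §5 (5.1)–(5.3) and Prop. 5.3] -/
theorem stub_tiltedProductMartingale :
    ∀ (κ : ℝ≥0) (α lam : ℝ), 0 < κ → κ ≤ 8 / 3 → α = (6 - κ) / (2 * κ) →
      lam = (8 - 3 * κ) * (6 - κ) / (2 * κ) → ∀ (A : Set ℂ) (hA : IsStarHull A) (hne : A.Nonempty) (n k : ℕ), n ≤ k →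
      Martingale (fun t ω => imgMartK κ hA hne n t ω * locMartK κ α lam hA hne k t ω) brownianFiltration
        preWienerMeasure :=
  fun _ _ _ hκ0 hκ hαdef hlamdef _ _ _ _ _ hnk ↦ martingale_imgMartK_mul_locMartK hκ0 hκ hαdef hlamdef hnk

end Registered

end Summit.CriticalPhenomena.SAWScalingLimit.Theorems.SubseqIdentification.BoundaryAreaLaw

end
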